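import Literature.MathematicalPhysics.QuantumFieldTheory.Balaban1983to89.B9SectCDiffCutModelToy11

/-!
# `Balaban1983to89.B9SectCDiffCutModelToy12` — THE FIRST INHABITANT OF THEOREM D's FULL HYPOTHESIS RECORD `EstHyp`
WITH `∂ ≠ 0` AND TWO DIFFERENT SEQUENCES: the `(L)` datum of the potential datum `Xpot` for a ZONE-SUPPORTED
potential, the assembled `EstHyp`, and THEOREM D's conclusion instantiated (census `b2b-balaban-r1/SectC-inst-census.md`
§6 (a⁵) ff.; notes N17–N18)

B9 = T. Bałaban, *Propagators for lattice gauge theories in a background field*, Commun. Math. Phys. **99**, 389–434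
(1985) [Balaban1985BackgroundPropagators].

CITATION HEADER (lean-in-tree rule 2026-08-18).  Cell `pub-balaban`, unit `b2b-balaban-r1-g18` (READER GROUP A,
lineage r1, gen 18), journal claim `SECTC-DIFF-CUTMODEL-TOY12` (successor of the same unit's `…Toy11` under claim
`SECTC-DIFF-CUTMODEL-TOY11`).  Source: doi:10.1007/bf01240355, held `paper:balaban1985-cmp99-background-propagators`,
journal page = PDF page + 388.  This unit re-read NO page and introduces NO quotation: the printed shapes inhabited
here are the `(L)` bundle `LDat` and the assembler `assemble` of `…B9SectCDiffAssembly` (the multiplication-type local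
defects and the three one-sided forms of B9's (3.100), pp. 413–414 [PDF 25–26], quoted VERBATIM in the header of
`…B9SectCDiffEstimate`; the p. 414 [PDF 26] sentence and the (3.100) cite tag in `…B9SectCDiffAssembly`'s header ∕
`LDat` docstring — pointer corrected in v1.1 after cross-read `b2b-balaban-pv03/XREAD-B9SectCDiffCutModelToy12-v1.md`
D1; docstring-only change), the 40-field hypothesis record `EstHyp` of `…B9SectCDiffEstimate` (Theorem 3.1
(3.42), p. 397 [PDF 9], quoted VERBATIM in the header of that module) and its conclusion `EstHyp.dT_entry` (the typed
(3.97), p. 412 [PDF 24]); the present declarations point to those quotations BY NAME only.  Tree inputs (by name):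
`B9SectCDiff.tdef_def`, `B9SectCDiffExpansion.TwoSeq.{dQ, dQt, dD, dDt, dΛ, dA, dQ', dQ't, dA'₁, dA'₂, ddA', dG',
dG'_eq', T₁, T₂, dT}`, `B9SectCDiffEstimate.{OpZon, EstHyp, EstHyp.dT_entry, Frame.σ}`, `B9SectCDiffAssembly.{LDat,
assemble}`, `B6DomainMajorant.zoneDepth_eq_zero`, `B9SectCDiffCutModelToy.{bdist, bdist_self, bdist_isPseudoDist, Qp}`,
`B9SectCDiffCutModelToy2.Qpt`, `B9SectCDiffCutModelToy3.{toyFrame, toyFrame_valid, toyFrame_profile₁, toyFrame_ρ,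
toyFrame_β, toyFrame_sc, toyFrame_K, toyFrame_Λ, toyFrame_u, toyFrame_δ₀, opZon_zero}`, `B9SectCDiffCutModelToy4.{Dfw,
Dbw, Sh_apply, opZon_local_toy}`, `B9SectCDiffCutModelToy5.Gr`, `B9SectCDiffCutModelToy8.Gtoy`, `B9SectCDiffDict.opZon_mono`,
`B9SectCDiffCutModelToy11.{Gv, Gtoyv, Xpot, Xpot_*, mOne_Xpot, mTwo_Xpot, Xpot_G'₂_ne_G'₁, tcap_nonneg, vcut, vcut_nonneg,
vcut_le, vcut_of_le, Xcut, ha20_of, haB_of}`; Mathlib otherwise.  Cell rows: GAPS C-r1g13-1 (the cut model), C-r1g14-1 …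
C-r1g18-1 (the toys 1–11), this module's row C-r1g18-2; census §6 (a⁵) / notes N10–N18.  No `HarnessLib` fact, no
named-fact `Prop`, no `instance`, no new predicate; no `sorry`.

## WHAT THIS MODULE DOES

Toy11's `Xpot` is a `TwoSeq` datum with `∂ ≠ 0` whose two sequences differ (in `A′`, `G′`, `C`, `G`) and agree in
their averaging, carriers, `Λ`, `Λ′`, `A`, `∂`, `∂*`; its intertwiners are `χ = ψ = 1`.  Consequently every twisted
difference `𝔇(T) = χ·T₂ − T₁·ψ` of a SHARED operator vanishes, and the only non-zero local defect is the composite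
scalar defect `𝔇(Δ′_a) = A′₂ − A′₁ = diag v` — a diagonal operator supported where the potential lives.  If the
potential is supported on the blocks of the frame's zone `N`, this defect lies in the zone class `𝒵(−2, 3a²)`, the
`(L)` bundle `LDat` is inhabited with all coefficient operators `0` except `Am₀ = diag v`, and the cell's assembler
yields THEOREM D's full hypothesis record:

* §1 THE DIFFERENCES OF `Xpot`: the missing `rfl` projections (`χs χb ψS ψB Λ A₁ A₂ Q₂ Qt₁`), `∂ ≠ 0` as a lemma
  (`Dfw_ne_zero`, `Xpot_D_ne_zero`), **`Xpot_dQ = Xpot_dQt = Xpot_dD = Xpot_dDt = Xpot_dΛ = Xpot_dA = Xpot_dQ' =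
  Xpot_dQ't = 0`**, **`Xpot_ddA' : 𝔇(Δ′_a) = diag v`**, **`Xpot_dG' : 𝔇(G′) = −G′(μ)·diag v·G_v`** (the cell's inverse
  rule `dG'_eq'` — consistent with Toy11's resolvent identity `Gv_eq_sub_left`), `Xpot_dT` (the difference of the two
  minimal-propagator-type operators `Q′G₂Q′* − Q′G₁Q′*`);
* §2 **`opZon_diagonal_toy`**: a diagonal operator `diag w` with `|w| ≤ θ₁·Bᵏ` supported on zone blocks lies in
  `𝒵(k, θ₁)` for any block maps over the block projection (Toy4's local-operator engine `opZon_local_toy` at range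
  `R = 0`), and `opZon_zero_toy` (the zero operator in every `𝒵(k, θ)`, `θ ≥ 0`, without frame validity);
* §3 **`ldatXpot`** — the `(L)` datum of `Xpot` for a zone-supported potential (`v x ≠ 0 ⇒ x.1 ∈ N`) at
  `θ = 3a²`: `Lm₁ = Lm₀ = Dm₁ = Dm₀ = Am₁ = 0`, `Am₀ = diag v`, the seven defect classes and the four coefficient
  classes by `opZon_zero_toy`, `zAm₀` by `opZon_diagonal_toy`; **`estHypXpot := assemble …`** — `EstHyp` for `Xpot`
  on `toyFrame` (`2²⁴ ≤ a`, `2a ≤ B`, `0 < δ₀ ≤ 1/2`, zone-supported `v`), with `estHypXpot_c : c = 256a⁴`,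
  `estHypXpot_θ : θ = 3a²`;
* §4 THE ZONE POTENTIAL `vzone t N` (`= t` on the blocks of `N`, `0 elsewhere`), **`Xzone n B N a ha haB`**,
  **`estHypXzone`**, the honesty lemmas `Xzone_D_ne_zero`, **`Xzone_G'₂_ne_G'₁`** (the sequences differ as soon as
  the zone is non-empty), and the cut potential of Toy11: **`estHypXcut`** for any zone containing the left blocks;
* §5 THEOREM D's CONCLUSION INSTANTIATED: `toyFrame_σ : σ = 0`, **`Xpot_dT_entry`** / **`Xzone_dT_entry`**:
  `|(Q′G₂Q′* − Q′G₁Q′*)(I, J)| ≤ 22·3a²·(256a⁴·n(B+1))¹⁵·B²` — the cell's `EstHyp.dT_entry` with every hypothesis of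
  the pipeline DISCHARGED on a datum with `∂ ≠ 0` and two different sequences (the left side is not certified
  non-zero here — `G′₂ ≠ G′₁` and `A′₂ ≠ A′₁` are; the inequality itself is of no interest).

HONEST CAVEATS.  (1) The intertwiners are `χ = ψ = 1`: B9's `χ`, `ψ` localise to one side of the cut surface; here
the localisation of the defects is carried by the SUPPORT of the potential instead (the frame's zone `N` must contain
every block where `v ≠ 0`), and THEOREM D's left side is the FULL difference `Q′G₂Q′* − Q′G₁Q′*`.  (2) The Leibniz
block of `(L)` is trivial (`Lm = Dm = Am₁ = 0`) because `Λ`, `∂`, `∂*`, `Q`, `Q*` are shared by the two sequences —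
only `Δ′_a` differs; Toy4's genuine Leibniz block (for differing `Λ`, `∂(1−P)∂*` under a cutoff `h`) is not exercised.
(3) `diag v` is a non-negative diagonal site potential, NOT B9's averaging penalties `Q′*aQ′` (Toy11's caveat (1)).
(4) The toy frame has `u = δ₀/20`, hence output rate `σ = (δ₀ − 20u)/2 = 0`: THEOREM D's bound carries NO decay here,
and its profile constant `K = n(B+1)` is volume-dependent — both are artefacts of Toy3's frame (a frame with `u = δ₀/40`
and a geometric profile would cure both; the level-0 classes do not see `u` or `K`).  (5) The constants `256a⁴`, `3a²`,
`22·(…)¹⁵` are artefacts.  Value = kernel certificate that the 40-field hypothesis record of THEOREM D is inhabited —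
and its conclusion therefore instantiated — with `∂ ≠ 0` by genuine finite-volume operators forming two DIFFERENT
sequences; TOY, one-dimensional — NOT summit progress.
-/

namespace Literature.MathematicalPhysics.QuantumFieldTheory.Balaban1983to89.B9SectCDiffCutModelToy12

open Finset Real
open B9SectCDiffEstimate
open B9SectCDiffAssembly
open B9SectCDiffExpansion (TwoSeq)
open B9SectCDiffCutModel
open B9SectCDiffCutModelToy
open B9SectCDiffCutModelToy2
open B9SectCDiffCutModelToy3
open B9SectCDiffCutModelToy4
open B9SectCDiffCutModelToy5
open B9SectCDiffCutModelToy6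
open B9SectCDiffCutModelToy7
open B9SectCDiffCutModelToy8
open B9SectCDiffCutModelToy9
open B9SectCDiffCutModelToy10
open B9SectCDiffCutModelToy11

noncomputable section

/-! ## §1 The local defects of the potential datum -/

section Differences

variable {n B : ℕ} {a : ℝ} {v : Fin n × Fin B → ℝ} {ha : 16777216 ≤ a} {haB : 2 * a ≤ (B : ℝ)}
  {hv0 : ∀ x, 0 ≤ v x} {hv1 : ∀ x, v x ≤ 3 * (a / B) ^ 2}

/-- [folklore] -/
@[simp] theorem Xpot_χs : (Xpot n B a v ha haB hv0 hv1).χs = 1 := rfl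
/-- [folklore] -/
@[simp] theorem Xpot_χb : (Xpot n B a v ha haB hv0 hv1).χb = 1 := rfl
/-- [folklore] -/
@[simp] theorem Xpot_ψS : (Xpot n B a v ha haB hv0 hv1).ψS = 1 := rfl
/-- [folklore] -/
@[simp] theorem Xpot_ψB : (Xpot n B a v ha haB hv0 hv1).ψB = 1 := rfl
/-- [folklore] -/
@[simp] theorem Xpot_Λ : (Xpot n B a v ha haB hv0 hv1).Λ = Lam n B ((a / B) ^ 2) := rfl
/-- [folklore] -/
@[simp] theorem Xpot_A₁ : (Xpot n B a v ha haB hv0 hv1).A₁ = 0 := rfl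
/-- [folklore] -/
@[simp] theorem Xpot_A₂ : (Xpot n B a v ha haB hv0 hv1).A₂ = 0 := rfl
/-- [folklore] -/
@[simp] theorem Xpot_Q₂ : (Xpot n B a v ha haB hv0 hv1).Q₂ = Qp n B := rfl
/-- [folklore] -/
@[simp] theorem Xpot_Qt₁ : (Xpot n B a v ha haB hv0 hv1).Qt₁ = Qpt n B := rfl

/-- the forward difference has diagonal `−1`. [folklore] -/
theorem Dfw_apply_self (x : Fin n × Fin B) : Dfw n B x x = -1 := by
  rw [Dfw, Matrix.sub_apply, Sh_apply, if_neg (by omega), Matrix.one_apply_eq, zero_sub]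

/-- **`∂ ≠ 0`** on a non-empty carrier. [folklore] -/
theorem Dfw_ne_zero (x : Fin n × Fin B) : Dfw n B ≠ 0 := fun h => by
  have := congrFun (congrFun h x) x
  rw [Dfw_apply_self, Matrix.zero_apply] at this
  norm_num at this

/-- `∂ ≠ 0` for the potential datum (given any site). [folklore] -/
theorem Xpot_D_ne_zero (x : Fin n × Fin B) : (Xpot n B a v ha haB hv0 hv1).D ≠ 0 := by
  rw [Xpot_D]; exact Dfw_ne_zero x

/-- a twisted difference with unit intertwiners of a shared operator vanishes. [folklore] -/
theorem tdef_one_one_self {u w : Type*} [Fintype u] [DecidableEq u] [Fintype w] [DecidableEq w]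
    (T : Matrix u w ℝ) : B9SectCDiff.tdef (1 : Matrix u u ℝ) (1 : Matrix w w ℝ) T T = 0 := by
  rw [B9SectCDiff.tdef_def, Matrix.one_mul, Matrix.mul_one, sub_self]

/-- a twisted difference with unit intertwiners is the plain difference. [folklore] -/
theorem tdef_one_one {u w : Type*} [Fintype u] [DecidableEq u] [Fintype w] [DecidableEq w]
    (T₁ T₂ : Matrix u w ℝ) : B9SectCDiff.tdef (1 : Matrix u u ℝ) (1 : Matrix w w ℝ) T₁ T₂ = T₂ - T₁ := by
  rw [B9SectCDiff.tdef_def, Matrix.one_mul, Matrix.mul_one]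

/-- `𝔇(Q) = 0`. [folklore] -/
theorem Xpot_dQ : (Xpot n B a v ha haB hv0 hv1).dQ = 0 := by
  rw [B9SectCDiffExpansion.TwoSeq.dQ, Xpot_ψB, Xpot_χb, Xpot_Q₁, Xpot_Q₂]; exact tdef_one_one_self _

/-- `𝔇(Q*) = 0`. [folklore] -/
theorem Xpot_dQt : (Xpot n B a v ha haB hv0 hv1).dQt = 0 := by
  rw [B9SectCDiffExpansion.TwoSeq.dQt, Xpot_ψB, Xpot_χb, Xpot_Qt₁, Xpot_Qt₂]; exact tdef_one_one_self _

/-- `𝔇(∂) = 0`. [folklore] -/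
theorem Xpot_dD : (Xpot n B a v ha haB hv0 hv1).dD = 0 := by
  rw [B9SectCDiffExpansion.TwoSeq.dD, Xpot_χb, Xpot_χs]; exact tdef_one_one_self _

/-- `𝔇(∂*) = 0`. [folklore] -/
theorem Xpot_dDt : (Xpot n B a v ha haB hv0 hv1).dDt = 0 := by
  rw [B9SectCDiffExpansion.TwoSeq.dDt, Xpot_χb, Xpot_χs]; exact tdef_one_one_self _

/-- `𝔇(Λ) = 0`. [folklore] -/
theorem Xpot_dΛ : (Xpot n B a v ha haB hv0 hv1).dΛ = 0 := by
  rw [B9SectCDiffExpansion.TwoSeq.dΛ, Xpot_χb]; exact tdef_one_one_self _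

/-- `𝔇(A) = 0` (both vector multi-level terms vanish). [folklore] -/
theorem Xpot_dA : (Xpot n B a v ha haB hv0 hv1).dA = 0 := by
  rw [B9SectCDiffExpansion.TwoSeq.dA, Xpot_χb, Xpot_A₁, Xpot_A₂]; exact tdef_one_one_self _

/-- `𝔇(Q′) = 0`. [folklore] -/
theorem Xpot_dQ' : (Xpot n B a v ha haB hv0 hv1).dQ' = 0 := by
  rw [B9SectCDiffExpansion.TwoSeq.dQ', Xpot_ψS, Xpot_χs, Xpot_Q'₁, Xpot_Q'₂]; exact tdef_one_one_self _

/-- `𝔇(Q′*) = 0`. [folklore] -/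
theorem Xpot_dQ't : (Xpot n B a v ha haB hv0 hv1).dQ't = 0 := by
  rw [B9SectCDiffExpansion.TwoSeq.dQ't, Xpot_ψS, Xpot_χs, Xpot_Q't₁, Xpot_Q't₂]; exact tdef_one_one_self _

/-- **THE ONE NON-ZERO DEFECT: `𝔇(Δ′_a) = A′₂ − A′₁ = diag v`.** [folklore] -/
theorem Xpot_ddA' : (Xpot n B a v ha haB hv0 hv1).ddA' = Matrix.diagonal v := by
  rw [B9SectCDiffExpansion.TwoSeq.ddA', B9SectCDiffExpansion.TwoSeq.dA'₁, B9SectCDiffExpansion.TwoSeq.dA'₂,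
    Xpot_χs, tdef_one_one, Xpot_A'₁, Xpot_A'₂, add_zero, add_sub_cancel_left]

/-- **`𝔇(G′) = −G′(μ)·diag v·G_v`** (the cell's inverse rule `dG'_eq'`; cf. Toy11's `Gv_eq_sub_left`). [folklore] -/
theorem Xpot_dG' : (Xpot n B a v ha haB hv0 hv1).dG' =
    -(Gr n B ((a / B) ^ 2) * Matrix.diagonal v * Gv n B ((a / B) ^ 2) v) := by
  rw [B9SectCDiffExpansion.TwoSeq.dG'_eq', Xpot_ddA', Xpot_G'₁, Xpot_G'₂]

/-- consistency with Toy11's resolvent identity: `G_v − G′(μ) = −G′(μ)·diag v·G_v` (`μ > 0`, `v ≥ 0`). [folklore] -/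
theorem Gv_sub_Gr {μ : ℝ} (hμ : 0 < μ) (hv0 : ∀ x, 0 ≤ v x) :
    Gv n B μ v - Gr n B μ = -(Gr n B μ * Matrix.diagonal v * Gv n B μ v) := by
  nth_rewrite 1 [Gv_eq_sub_left hμ hv0]; rw [sub_sub_cancel_left]

/-- the difference of the two minimal-propagator-type operators: `𝔇(QGQ*) = Q′·G₂·Q′* − Q′·G₁·Q′*`. [folklore] -/
theorem Xpot_dT : (Xpot n B a v ha haB hv0 hv1).dT =
    Qp n B * Gtoyv n B ((a / B) ^ 2) ((a / B) ^ 2) v * Qpt n B - Qp n B * Gtoy n B ((a / B) ^ 2) ((a / B) ^ 2) * Qpt n B := by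
  rw [B9SectCDiffExpansion.TwoSeq.dT, B9SectCDiffExpansion.TwoSeq.T₁, B9SectCDiffExpansion.TwoSeq.T₂, Xpot_ψB,
    tdef_one_one, Xpot_Q₁, Xpot_Q₂, Xpot_Qt₁, Xpot_Qt₂, Xpot_G₁, Xpot_G₂]

end Differences

/-! ## §2 Zone classes of diagonal operators on the toy frame -/

section Zone

variable {n B : ℕ} {N : Finset (Fin n)} {hN : N.Nonempty} {δ₀ : ℝ}
variable {U V : Type*} [DecidableEq V] {bu : Fin n × Fin B → U} {bv : Fin n × Fin B → V} {pU : U → Fin n}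
  {pV : V → Fin n}

/-- a block of the zone has depth `0`. [folklore] -/
theorem toyFrame_β_eq_zero {I : Fin n} (hI : I ∈ N) : (toyFrame n B N hN δ₀).β I = 0 := by
  show B6DomainMajorant.zoneDepth (bdist n) N hN I = 0
  exact B6DomainMajorant.zoneDepth_eq_zero (bdist_isPseudoDist n) hN hI

/-- **A ZONE-SUPPORTED DIAGONAL OPERATOR IS IN `𝒵(k, θ₁)`**: `|w| ≤ θ₁·Bᵏ` and `w(x) ≠ 0 ⇒ block(x) ∈ N` give
`diag w ∈ 𝒵(k, θ₁)` on the toy frame, for any block maps over the block projection (Toy4's `opZon_local_toy` at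
range `0`). [folklore] -/
theorem opZon_diagonal_toy (hB : 0 < B) (hδ₀ : 0 < δ₀) {w : Fin n × Fin B → ℝ} {k : ℤ} {θ₁ : ℝ} (hθ : 0 ≤ θ₁)
    (hbu : ∀ x, pU (bu x) = x.1) (hbv : ∀ x, pV (bv x) = x.1) (hsup : ∀ x, |w x| ≤ θ₁ * (B : ℝ) ^ k)
    (hz : ∀ x, w x ≠ 0 → x.1 ∈ N) :
    OpZon (toyFrame n B N hN δ₀) bu bv pU pV k θ₁ (Matrix.diagonal w) := by
  rw [show θ₁ = θ₁ * Real.exp (δ₀ * 0) by rw [mul_zero, Real.exp_zero, mul_one]]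
  refine opZon_local_toy hB hδ₀ hθ hbu hbv (fun x => ?_) (fun x x' hT => ?_) (fun x x' => ?_) (fun x x' hT => ?_)
  · refine card_le_one.2 fun y hy z hz' => ?_
    rw [mem_filter] at hy hz'
    have hy' : x = y := by by_contra hne; exact hy.2 (Matrix.diagonal_apply_ne _ hne)
    have hz'' : x = z := by by_contra hne; exact hz'.2 (Matrix.diagonal_apply_ne _ hne)
    rw [← hy', ← hz'']
  · have : x = x' := by by_contra hne; exact hT (Matrix.diagonal_apply_ne _ hne)
    rw [this, bdist_self]
  · by_cases hxx : x = x'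
    · subst hxx; rw [Matrix.diagonal_apply_eq]; exact hsup x
    · rw [Matrix.diagonal_apply_ne _ hxx, abs_zero]
      exact mul_nonneg hθ (zpow_nonneg (Nat.cast_nonneg B) k)
  · have : x = x' := by by_contra hne; exact hT (Matrix.diagonal_apply_ne _ hne)
    subst this
    rw [Matrix.diagonal_apply_eq] at hT
    exact toyFrame_β_eq_zero (hz x hT)

/-- the zero operator lies in every `𝒵(k, θ)`, `θ ≥ 0`, on the toy frame (no validity needed). [folklore] -/
theorem opZon_zero_toy {u w U' V' : Type*} [Fintype w] [DecidableEq V'] (bu' : u → U') (bw : w → V')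
    (pU' : U' → Fin n) (pV' : V' → Fin n) (k : ℤ) {θ : ℝ} (hθ : 0 ≤ θ) :
    OpZon (toyFrame n B N hN δ₀) bu' bw pU' pV' k θ (0 : Matrix u w ℝ) := by
  refine ⟨0, ⟨fun _ _ => le_refl _, fun _ _ => by simp⟩, fun I J => ?_, fun _ _ h => (h rfl).elim⟩
  simp only [Matrix.zero_apply, abs_zero, toyFrame_sc]
  exact mul_nonneg (mul_nonneg hθ (zpow_nonneg (Nat.cast_nonneg B) k)) (Real.exp_nonneg _)

end Zone

/-! ## §3 The `(L)` datum of `Xpot` for a zone-supported potential; the assembled `EstHyp` -/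

section LSide

variable {n B : ℕ} {N : Finset (Fin n)} {hN : N.Nonempty} {δ₀ : ℝ}
variable {a : ℝ} {v : Fin n × Fin B → ℝ} {ha : 16777216 ≤ a} {haB : 2 * a ≤ (B : ℝ)}
  {hv0 : ∀ x, 0 ≤ v x} {hv1 : ∀ x, v x ≤ 3 * (a / B) ^ 2}

/-- `2²⁴ ≤ a`, `2a ≤ B ⇒ 0 < B`. [folklore] -/
theorem hBnat_of (ha : 16777216 ≤ a) (haB : 2 * a ≤ (B : ℝ)) : 0 < B := by
  have : (0 : ℝ) < B := by linarith
  exact_mod_cast this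

/-- the potential bound on the proper scale: `|v x| ≤ 3a²·B⁻²`. [folklore] -/
theorem abs_v_le (hv0 : ∀ x, 0 ≤ v x) (hv1 : ∀ x, v x ≤ 3 * (a / B) ^ 2) (x : Fin n × Fin B) :
    |v x| ≤ 3 * a ^ 2 * (B : ℝ) ^ (-2 : ℤ) := by
  rw [abs_of_nonneg (hv0 x), zpow_neg, zpow_ofNat]
  calc v x ≤ 3 * (a / B) ^ 2 := hv1 x
    _ = 3 * a ^ 2 * ((B : ℝ) ^ 2)⁻¹ := by rw [div_pow, div_eq_mul_inv, mul_assoc]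

/-- **THE `(L)` DATUM OF THE POTENTIAL DATUM** for a zone-supported potential (`v x ≠ 0 ⇒ x.1 ∈ N`) at `θ = 3a²`:
the seven multiplication-type defects vanish (`opZon_zero_toy`), the three one-sided forms hold with
`Lm₁ = Lm₀ = Dm₁ = Dm₀ = Am₁ = 0` and `Am₀ = 𝔇(Δ′_a) = diag v ∈ 𝒵(−2, 3a²)` (`opZon_diagonal_toy`).  Block maps and
`∇ := 0` as in Toy11's `mOne_Xpot`/`mTwo_Xpot`.  OURS. [folklore] -/
def ldatXpot (hδ₀ : 0 < δ₀) (hvN : ∀ x, v x ≠ 0 → x.1 ∈ N) :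
    LDat (toyFrame n B N hN δ₀) (Xpot n B a v ha haB hv0 hv1) id id Prod.fst Prod.fst id id Prod.fst Prod.fst
      Prod.fst id id (0 : Matrix (Fin n × Fin B) (Fin n × Fin B) ℝ) (3 * a ^ 2) where
  Lm₁ := 0
  Lm₀ := 0
  Dm₁ := 0
  Dm₀ := 0
  Am₁ := 0
  Am₀ := Matrix.diagonal v
  zQ := by rw [Xpot_dQ]; exact opZon_zero_toy _ _ _ _ _ (by positivity)
  zQt := by rw [Xpot_dQt]; exact opZon_zero_toy _ _ _ _ _ (by positivity)
  zD := by rw [Xpot_dD]; exact opZon_zero_toy _ _ _ _ _ (by positivity)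
  zDt := by rw [Xpot_dDt]; exact opZon_zero_toy _ _ _ _ _ (by positivity)
  zA := by rw [Xpot_dA]; exact opZon_zero_toy _ _ _ _ _ (by positivity)
  zQ' := by rw [Xpot_dQ']; exact opZon_zero_toy _ _ _ _ _ (by positivity)
  zQ't := by rw [Xpot_dQ't]; exact opZon_zero_toy _ _ _ _ _ (by positivity)
  hΛ := by rw [Xpot_dΛ, Matrix.zero_mul, add_zero]
  zLm₁ := opZon_zero_toy _ _ _ _ _ (by positivity)
  zLm₀ := opZon_zero_toy _ _ _ _ _ (by positivity)
  hM := by rw [Xpot_dDt, Matrix.mul_zero, Matrix.zero_mul, add_zero]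
  zDm₁ := opZon_zero_toy _ _ _ _ _ (by positivity)
  zDm₀ := opZon_zero_toy _ _ _ _ _ (by positivity)
  hA := by rw [Xpot_ddA', Xpot_D, Matrix.zero_mul, zero_add]
  zAm₁ := opZon_zero_toy _ _ _ _ _ (by positivity)
  zAm₀ := opZon_diagonal_toy (hBnat_of ha haB) hδ₀ (by positivity) (fun _ => rfl) (fun _ => rfl)
    (abs_v_le hv0 hv1) hvN

/-- **THE FIRST `EstHyp` WITH `∂ ≠ 0` AND TWO DIFFERENT SEQUENCES**: (M) of both sequences at `256a⁴` (Toy11's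
`mOne_Xpot`, `mTwo_Xpot`), (L) at `3a²` (`ldatXpot`), the profiles of the toy frame, assembled by the cell's
`assemble`; hypotheses `2²⁴ ≤ a`, `2a ≤ B`, `0 ≤ v ≤ 3(a/B)²` zone-supported, `0 < δ₀ ≤ 1/2`.  OURS.
[folklore] -/
def estHypXpot (hδ₀ : 0 < δ₀) (hδ : δ₀ ≤ 1 / 2) (hvN : ∀ x, v x ≠ 0 → x.1 ∈ N) :
    EstHyp (toyFrame n B N hN δ₀) (Xpot n B a v ha haB hv0 hv1) (Fin n × Fin B) (Fin n) (Fin n) :=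
  assemble (toyFrame_valid (hBnat_of ha haB) hN hδ₀) (mOne_Xpot hδ) (mTwo_Xpot hδ) (ldatXpot hδ₀ hvN)
    (by positivity) (by positivity) (by positivity) toyFrame_profile₁ toyFrame_profile₁

/-- `1 ≤ 256a⁴`. [folklore] -/
theorem one_le_c (ha : 16777216 ≤ a) : (1 : ℝ) ≤ 256 * a ^ 4 := by
  have : (1 : ℝ) ≤ a := by linarith
  nlinarith [pow_le_pow_left₀ zero_le_one this 4]

/-- the assembled (M) constant is `max(1, 256a⁴, 256a⁴) = 256a⁴`. [folklore] -/
theorem estHypXpot_c (hδ₀ : 0 < δ₀) (hδ : δ₀ ≤ 1 / 2) (hvN : ∀ x, v x ≠ 0 → x.1 ∈ N) :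
    (estHypXpot (ha := ha) (haB := haB) (hv0 := hv0) (hv1 := hv1) (hN := hN) hδ₀ hδ hvN).c = 256 * a ^ 4 := by
  show max 1 (max (256 * a ^ 4) (256 * a ^ 4)) = 256 * a ^ 4
  rw [max_self, max_eq_right (one_le_c ha)]

/-- the assembled (L) constant is `3a²`. [folklore] -/
theorem estHypXpot_θ (hδ₀ : 0 < δ₀) (hδ : δ₀ ≤ 1 / 2) (hvN : ∀ x, v x ≠ 0 → x.1 ∈ N) :
    (estHypXpot (ha := ha) (haB := haB) (hv0 := hv0) (hv1 := hv1) (hN := hN) hδ₀ hδ hvN).θ = 3 * a ^ 2 := rfl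

end LSide

/-! ## §4 The zone potential and the cut potential -/

section ZonePot

variable {n B : ℕ} {N : Finset (Fin n)} {hN : N.Nonempty} {δ₀ : ℝ}

/-- the zone potential: height `t` on the blocks of `N`, `0` elsewhere. OURS (typing). [folklore] -/
def vzone (n B : ℕ) (t : ℝ) (N : Finset (Fin n)) (x : Fin n × Fin B) : ℝ := if x.1 ∈ N then t else 0

/-- [folklore] -/
theorem vzone_nonneg {t : ℝ} (ht : 0 ≤ t) (N : Finset (Fin n)) (x : Fin n × Fin B) : 0 ≤ vzone n B t N x := by
  unfold vzone; split_ifs <;> linarith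

/-- [folklore] -/
theorem vzone_le {t : ℝ} (ht : 0 ≤ t) (N : Finset (Fin n)) (x : Fin n × Fin B) : vzone n B t N x ≤ t := by
  unfold vzone; split_ifs <;> linarith

/-- [folklore] -/
theorem vzone_of_mem {t : ℝ} {x : Fin n × Fin B} (h : x.1 ∈ N) : vzone n B t N x = t := by
  unfold vzone; rw [if_pos h]

/-- [folklore] -/
theorem vzone_of_not_mem {t : ℝ} {x : Fin n × Fin B} (h : x.1 ∉ N) : vzone n B t N x = 0 := by
  unfold vzone; rw [if_neg h]

/-- the zone potential is supported on the zone. [folklore] -/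
theorem mem_of_vzone_ne_zero {t : ℝ} {x : Fin n × Fin B} (h : vzone n B t N x ≠ 0) : x.1 ∈ N := by
  by_contra hx; exact h (vzone_of_not_mem hx)

/-- **THE ZONE DATUM** `Xzone := Xpot` with the zone potential of height `3(a/B)²` on the blocks of `N`.  OURS.
[folklore] -/
def Xzone (n B : ℕ) (N : Finset (Fin n)) (a : ℝ) (ha : 16777216 ≤ a) (haB : 2 * a ≤ (B : ℝ)) :
    TwoSeq (Fin n × Fin B) (Fin n × Fin B) (Fin n) (Fin n) (Fin n) (Fin n) :=
  Xpot n B a (vzone n B (3 * (a / B) ^ 2) N) ha haB (vzone_nonneg (tcap_nonneg a B) N)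
    (vzone_le (tcap_nonneg a B) N)

variable {a : ℝ} {ha : 16777216 ≤ a} {haB : 2 * a ≤ (B : ℝ)}

/-- **`EstHyp` FOR THE ZONE DATUM** (`2²⁴ ≤ a`, `2a ≤ B`, `0 < δ₀ ≤ 1/2`, any non-empty zone). OURS. [folklore] -/
def estHypXzone (hN : N.Nonempty) (hδ₀ : 0 < δ₀) (hδ : δ₀ ≤ 1 / 2) :
    EstHyp (toyFrame n B N hN δ₀) (Xzone n B N a ha haB) (Fin n × Fin B) (Fin n) (Fin n) :=
  estHypXpot hδ₀ hδ fun _ h => mem_of_vzone_ne_zero h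

/-- [folklore] -/
theorem estHypXzone_nonempty (hN : N.Nonempty) (hδ₀ : 0 < δ₀) (hδ : δ₀ ≤ 1 / 2) :
    Nonempty (EstHyp (toyFrame n B N hN δ₀) (Xzone n B N a ha haB) (Fin n × Fin B) (Fin n) (Fin n)) :=
  ⟨estHypXzone hN hδ₀ hδ⟩

/-- [folklore] -/
theorem estHypXzone_c (hN : N.Nonempty) (hδ₀ : 0 < δ₀) (hδ : δ₀ ≤ 1 / 2) :
    (estHypXzone (ha := ha) (haB := haB) hN hδ₀ hδ).c = 256 * a ^ 4 :=
  estHypXpot_c hδ₀ hδ _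

/-- [folklore] -/
theorem estHypXzone_θ (hN : N.Nonempty) (hδ₀ : 0 < δ₀) (hδ : δ₀ ≤ 1 / 2) :
    (estHypXzone (ha := ha) (haB := haB) hN hδ₀ hδ).θ = 3 * a ^ 2 := rfl

/-- `∂ ≠ 0` for the zone datum (non-empty zone, `B > 0`). [folklore] -/
theorem Xzone_D_ne_zero (hN : N.Nonempty) : (Xzone n B N a ha haB).D ≠ 0 := by
  obtain ⟨I₀, _⟩ := hN
  exact Xpot_D_ne_zero (I₀, ⟨0, hBnat_of ha haB⟩)

/-- **THE TWO SEQUENCES OF THE ZONE DATUM DIFFER** (`G′₂ ≠ G′₁`) as soon as the zone is non-empty. [folklore] -/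
theorem Xzone_G'₂_ne_G'₁ (hN : N.Nonempty) : (Xzone n B N a ha haB).G'₂ ≠ (Xzone n B N a ha haB).G'₁ := by
  obtain ⟨I₀, hI₀⟩ := hN
  have ht : 0 < 3 * (a / B) ^ 2 := by
    have := muB_pos (ha20_of ha) (haB_of ha haB); positivity
  refine Xpot_G'₂_ne_G'₁ (x₀ := (I₀, ⟨0, hBnat_of ha haB⟩)) ?_
  rw [vzone_of_mem (by exact hI₀)]; exact ht.ne'

/-- `A′₂ ≠ A′₁` for the zone datum. [folklore] -/
theorem Xzone_A'₂_ne_A'₁ (hN : N.Nonempty) : (Xzone n B N a ha haB).A'₂ ≠ (Xzone n B N a ha haB).A'₁ := by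
  obtain ⟨I₀, hI₀⟩ := hN
  have ht : 0 < 3 * (a / B) ^ 2 := by
    have := muB_pos (ha20_of ha) (haB_of ha haB); positivity
  refine Xpot_A'₂_ne_A'₁ (x₀ := (I₀, ⟨0, hBnat_of ha haB⟩)) ?_
  rw [vzone_of_mem (by exact hI₀)]; exact ht.ne'

/-- the cut potential of Toy11 is supported on the left blocks. [folklore] -/
theorem lt_of_vcut_ne_zero {t : ℝ} {I₀ : ℕ} {x : Fin n × Fin B} (h : vcut n B t I₀ x ≠ 0) : (x.1 : ℕ) < I₀ := by
  by_contra hx; exact h (vcut_of_le (not_lt.mp hx))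

/-- **`EstHyp` FOR THE CUT DATUM** of Toy11, for any zone containing the blocks left of the cut. OURS. [folklore] -/
def estHypXcut {I₀ : ℕ} (hN : N.Nonempty) (hδ₀ : 0 < δ₀) (hδ : δ₀ ≤ 1 / 2)
    (hleft : ∀ I : Fin n, (I : ℕ) < I₀ → I ∈ N) :
    EstHyp (toyFrame n B N hN δ₀) (Xcut n B I₀ a ha haB) (Fin n × Fin B) (Fin n) (Fin n) :=
  estHypXpot hδ₀ hδ fun x h => hleft x.1 (lt_of_vcut_ne_zero h)

/-- [folklore] -/
theorem estHypXcut_c {I₀ : ℕ} (hN : N.Nonempty) (hδ₀ : 0 < δ₀) (hδ : δ₀ ≤ 1 / 2)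
    (hleft : ∀ I : Fin n, (I : ℕ) < I₀ → I ∈ N) :
    (estHypXcut (ha := ha) (haB := haB) hN hδ₀ hδ hleft).c = 256 * a ^ 4 :=
  estHypXpot_c hδ₀ hδ _

end ZonePot

/-! ## §5 THEOREM D's conclusion instantiated -/

section Conclusion

variable {n B : ℕ} {N : Finset (Fin n)} {δ₀ : ℝ}
variable {a : ℝ} {v : Fin n × Fin B → ℝ} {ha : 16777216 ≤ a} {haB : 2 * a ≤ (B : ℝ)}
  {hv0 : ∀ x, 0 ≤ v x} {hv1 : ∀ x, v x ≤ 3 * (a / B) ^ 2}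

/-- the toy frame's output rate `σ = (δ₀ − 20u)/2` VANISHES (`u = δ₀/20`) — HONEST: no decay survives. [folklore] -/
theorem toyFrame_σ {hN : N.Nonempty} : (toyFrame n B N hN δ₀).σ = 0 := by
  show (δ₀ - 20 * (δ₀ / 20)) / 2 = 0
  ring

/-- **THEOREM D's CONCLUSION FOR THE POTENTIAL DATUM**: the cell's `EstHyp.dT_entry` on `estHypXpot` with every
constant unfolded — `|(Q′G₂Q′* − Q′G₁Q′*)(I,J)| ≤ 22·3a²·(256a⁴·1·n(B+1))¹⁵·B²` (the shape factor is `e⁰ = 1` since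
`σ = 0` on the toy frame).  Every hypothesis of the pipeline is DISCHARGED; the inequality itself is of no interest.
OURS. [folklore] -/
theorem Xpot_dT_entry (hN : N.Nonempty) (hδ₀ : 0 < δ₀) (hδ : δ₀ ≤ 1 / 2) (hvN : ∀ x, v x ≠ 0 → x.1 ∈ N)
    (I J : Fin n) :
    |(Xpot n B a v ha haB hv0 hv1).dT I J| ≤
      22 * (3 * a ^ 2) * (256 * a ^ 4 * 1 * ((n : ℝ) * (B + 1))) ^ 15 * (B : ℝ) ^ (2 : ℤ) := by
  have h := (estHypXpot (ha := ha) (haB := haB) (hv0 := hv0) (hv1 := hv1) (hN := hN) hδ₀ hδ hvN).dT_entry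
    (toyFrame_valid (hBnat_of ha haB) hN hδ₀) I J
  rw [toyFrame_σ, zero_mul, neg_zero, Real.exp_zero, mul_one, estHypXpot_c, toyFrame_Λ, toyFrame_K,
    toyFrame_sc] at h
  exact h

/-- **THEOREM D's CONCLUSION FOR THE ZONE DATUM** (non-empty zone, `2²⁴ ≤ a`, `2a ≤ B`, `0 < δ₀ ≤ 1/2`). OURS.
[folklore] -/
theorem Xzone_dT_entry (hN : N.Nonempty) (hδ₀ : 0 < δ₀) (hδ : δ₀ ≤ 1 / 2) (I J : Fin n) :
    |(Xzone n B N a ha haB).dT I J| ≤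
      22 * (3 * a ^ 2) * (256 * a ^ 4 * 1 * ((n : ℝ) * (B + 1))) ^ 15 * (B : ℝ) ^ (2 : ℤ) :=
  Xpot_dT_entry hN hδ₀ hδ (fun _ h => mem_of_vzone_ne_zero h) I J

/-- the left side of THEOREM D for the zone datum is the difference `Q′·Gtoyv·Q′* − Q′·Gtoy·Q′*` of the two coarse
minimal-propagator-type operators (NOT certified non-zero here; what is certified is `G′₂ ≠ G′₁`, `A′₂ ≠ A′₁`).
[folklore] -/
theorem Xzone_dT : (Xzone n B N a ha haB).dT =
    Qp n B * Gtoyv n B ((a / B) ^ 2) ((a / B) ^ 2) (vzone n B (3 * (a / B) ^ 2) N) * Qpt n B -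
      Qp n B * Gtoy n B ((a / B) ^ 2) ((a / B) ^ 2) * Qpt n B :=
  Xpot_dT

end Conclusion

end

end Literature.MathematicalPhysics.QuantumFieldTheory.Balaban1983to89.B9SectCDiffCutModelToy12
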